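import Summits.AtomisticToContinuum.FouriersLaw.Theses.NoHiddenChargesKubo

/-!
# Route `NoHiddenChargesKubo` — the parity split of crux `ChargeCompleteness` (glue item, proved)

Closes the glue item `stmt-AtomisticToContinuum-17668`
(`Summit.AtomisticToContinuum.FouriersLaw.Theses.NoHiddenChargesKubo.ChargeCompletenessOfParity :
EvenChargeCompleteness → NoOddDrudeWeight → DrudeWeightExists → ChargeCompleteness`), the assembly of the
crux-strategist's BC2 redirect (RESTATED re-audit r1, 2026-08-17) of the route's deciding crux
`ChargeCompleteness` (stmt-AtomisticToContinuum-11915: Drude weights of local observables are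
Mazur-saturated by local polynomial charges — Doyon's completeness problem at wavenumber 0 for the
classical pinned chain) along momentum-reversal parity `R : (q, p) ↦ (q, -p)`:

* `EvenChargeCompleteness` (stmt-17666, crux) — `ChargeCompleteness` for momentum-EVEN `f ∈ LocObs`, with
  an EVEN saturating local polynomial charge `Q` (even-sector k = 0 hydrodynamic ergodicity);
* `NoOddDrudeWeight` (stmt-17667, crux) — for momentum-ODD `f ∈ LocObs` the Cesàro mean `τ⁻¹∫₀^τ K_f`
  tends to `0` (no ballistic channel in the whole odd sector; the part `HydroBridge` consumes at the
  clipped current);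
* `DrudeWeightExists` (stmt-11916, the route's existing support item) — Cesàro means of `K_f` converge to
  some `D_f ≥ 0` for every `f ∈ LocObs` (von Neumann / Bochner).

Proof of `chargeCompleteness_of_parity` (≈ 330 tactic lines; not a one-line seam — no two hypotheses
give the conclusion, and no hypothesis gives the crux or `FouriersLaw` by `exact?`/`aesop`, probes in the
strategist folder): split `f = fe + fo` into even and odd parts (`fe`, `fo ∈ LocObs` on the same box).
Along the pencil `u_s = fe + s·fo` the Cesàro means satisfy
`M[u_s](τ) = M[fe](τ) + s·M[cross](τ) + s²·M[fo](τ)` for `τ ≥ 0` (bilinearity of `Cov` by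
`integral_add` under clause (i), of `Σ_x` by `Summable.tsum_add` under the domination clause (ii) at
`t ≥ 0`, of `∫₀^τ` by `intervalIntegral.integral_add` with the continuity clause (iv)).
`NoOddDrudeWeight` gives `M[fo] → 0`; `DrudeWeightExists` at `f` and `fe` gives `M[f] → D_f`,
`M[fe] → A`, hence `M[cross] → D_f − A` (read off at `s = 1`); `DrudeWeightExists` at every `u_s` gives
`0 ≤ D(u_s) = A + s (D_f − A)` for all real `s`, hence `D_f = A`.  `EvenChargeCompleteness` at
`(fe, ε/2)` gives an even local charge `Q` with `A ≤ ⟨fe, Q⟩₀²/‖Q‖₀² + ε/2`, and `⟨f, Q⟩₀ = ⟨fe, Q⟩₀`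
because the static covariance of the odd `fo` with the even `Q ∘ shift^x` vanishes under the
reversal-invariant Gibbs state (`φ₀ = id` a.e. from `PreservesMeasure`; `integral_map_equiv`, no
integrability needed for the symmetry step; `integral_add` with clause (i) and `LocPoly ⊆ LocObs`, a
polynomial bound proved by induction on `MvPolynomial`).  Hence eventually
`τ⁻¹∫₀^τ K_f ≤ ⟨f, Q⟩₀²/‖Q‖₀² + ε`.
Helper lemmas: `measurable_reversal`, `integral_eq_zero_of_odd`, `abs_coord_le`,
`mvPolynomial_eval_bound`, `continuous_coordMap`, `continuous_mvPolynomial_eval`.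
-/

noncomputable section

namespace Summit.AtomisticToContinuum.FouriersLaw.Theorems.NoHiddenChargesKuboChargeCompletenessSplit

open Filter Set Function MeasureTheory
open scoped Topology BigOperators
open Literature.MathematicalPhysics.KineticTheory.HeatConduction
open Summit.AtomisticToContinuum.FouriersLaw.Theses.NoHiddenChargesKubo

/-! ## Helper lemmas -/

/-- Momentum reversal `σ ↦ (q, -p)` on `ChainConfig` is measurable. [folklore] -/
theorem measurable_reversal :
    Measurable (fun σ : ChainConfig => fun x : ℤ => ((σ x).1, -(σ x).2)) := by
  refine measurable_pi_lambda _ fun x => ?_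
  exact ((measurable_pi_apply x).fst).prodMk ((measurable_pi_apply x).snd.neg)

/-- The integral of a momentum-odd function against a reversal-invariant measure vanishes (no
integrability needed: `integral_map_equiv`). [folklore] -/
theorem integral_eq_zero_of_odd {μ : Measure ChainConfig}
    (hμ : μ.map (fun σ : ChainConfig => fun x : ℤ => ((σ x).1, -(σ x).2)) = μ)
    {u : ChainConfig → ℝ} (hu : ∀ σ, u (fun x => ((σ x).1, -(σ x).2)) = -u σ) :
    ∫ σ, u σ ∂μ = 0 := by
  let e : ChainConfig ≃ᵐ ChainConfig :=
    { toFun := fun σ x => ((σ x).1, -(σ x).2)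
      invFun := fun σ x => ((σ x).1, -(σ x).2)
      left_inv := fun σ => by funext x; simp
      right_inv := fun σ => by funext x; simp
      measurable_toFun := measurable_reversal
      measurable_invFun := measurable_reversal }
  have he : (e : ChainConfig → ChainConfig) = fun σ x => ((σ x).1, -(σ x).2) := rfl
  have h1 : ∫ σ, u σ ∂μ = ∫ σ, u (fun x => ((σ x).1, -(σ x).2)) ∂μ := by
    have h := integral_map_equiv (μ := μ) e u
    rw [he, hμ] at h
    simpa using h
  have h2 : ∫ σ, u (fun x => ((σ x).1, -(σ x).2)) ∂μ = -∫ σ, u σ ∂μ := by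
    rw [← integral_neg]
    exact integral_congr_ae (Eventually.of_forall hu)
  linarith

/-- Coordinates of a box configuration are bounded by its sup norm. [folklore] -/
theorem abs_coord_le {n : ℕ} (v : Fin (n + 1) → ℝ × ℝ) (i : Fin (n + 1) × Bool) :
    |(if i.2 then (v i.1).2 else (v i.1).1)| ≤ ‖v‖ := by
  have h1 : ‖v i.1‖ ≤ ‖v‖ := norm_le_pi_norm v i.1
  have h2 : |(v i.1).1| ≤ ‖v i.1‖ := by simpa only [Real.norm_eq_abs] using norm_fst_le (v i.1)
  have h3 : |(v i.1).2| ≤ ‖v i.1‖ := by simpa only [Real.norm_eq_abs] using norm_snd_le (v i.1)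
  split_ifs <;> linarith

/-- A polynomial in the box coordinates is polynomially bounded. [folklore] -/
theorem mvPolynomial_eval_bound {n : ℕ} (w : MvPolynomial (Fin (n + 1) × Bool) ℝ) :
    ∃ (C : ℝ) (k : ℕ), ∀ v : Fin (n + 1) → ℝ × ℝ,
      |MvPolynomial.eval (fun i : Fin (n + 1) × Bool => if i.2 then (v i.1).2 else (v i.1).1) w| ≤
        C * (1 + ‖v‖) ^ k := by
  refine MvPolynomial.induction_on
    (motive := fun w : MvPolynomial (Fin (n + 1) × Bool) ℝ => ∃ (C : ℝ) (k : ℕ),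
      ∀ v : Fin (n + 1) → ℝ × ℝ,
        |MvPolynomial.eval (fun i : Fin (n + 1) × Bool => if i.2 then (v i.1).2 else (v i.1).1) w| ≤
          C * (1 + ‖v‖) ^ k) w ?_ ?_ ?_
  · intro a
    exact ⟨|a|, 0, fun v => by simp⟩
  · rintro p q ⟨Cp, kp, hp⟩ ⟨Cq, kq, hq⟩
    refine ⟨|Cp| + |Cq|, kp + kq, fun v => ?_⟩
    have h1 : (1 : ℝ) ≤ 1 + ‖v‖ := le_add_of_nonneg_right (norm_nonneg v)
    have hkp : (1 + ‖v‖) ^ kp ≤ (1 + ‖v‖) ^ (kp + kq) :=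
      pow_le_pow_right₀ h1 (Nat.le_add_right kp kq)
    have hkq : (1 + ‖v‖) ^ kq ≤ (1 + ‖v‖) ^ (kp + kq) :=
      pow_le_pow_right₀ h1 (Nat.le_add_left kq kp)
    have hP : (0 : ℝ) ≤ (1 + ‖v‖) ^ kp := by positivity
    have hQ : (0 : ℝ) ≤ (1 + ‖v‖) ^ kq := by positivity
    have hpv := hp v
    have hqv := hq v
    have hCp : Cp * (1 + ‖v‖) ^ kp ≤ |Cp| * (1 + ‖v‖) ^ (kp + kq) :=
      (mul_le_mul_of_nonneg_right (le_abs_self Cp) hP).trans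
        (mul_le_mul_of_nonneg_left hkp (abs_nonneg Cp))
    have hCq : Cq * (1 + ‖v‖) ^ kq ≤ |Cq| * (1 + ‖v‖) ^ (kp + kq) :=
      (mul_le_mul_of_nonneg_right (le_abs_self Cq) hQ).trans
        (mul_le_mul_of_nonneg_left hkq (abs_nonneg Cq))
    rw [map_add]
    have habs := abs_add_le
      (MvPolynomial.eval (fun i : Fin (n + 1) × Bool => if i.2 then (v i.1).2 else (v i.1).1) p)
      (MvPolynomial.eval (fun i : Fin (n + 1) × Bool => if i.2 then (v i.1).2 else (v i.1).1) q)
    linarith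
  · rintro p i ⟨Cp, kp, hp⟩
    refine ⟨|Cp|, kp + 1, fun v => ?_⟩
    have hP : (0 : ℝ) ≤ (1 + ‖v‖) ^ kp := by positivity
    have hx : |(if i.2 then (v i.1).2 else (v i.1).1)| ≤ 1 + ‖v‖ :=
      (abs_coord_le v i).trans (le_add_of_nonneg_left zero_le_one)
    have hpv : |MvPolynomial.eval (fun i : Fin (n + 1) × Bool => if i.2 then (v i.1).2 else (v i.1).1) p|
        ≤ |Cp| * (1 + ‖v‖) ^ kp :=
      (hp v).trans (mul_le_mul_of_nonneg_right (le_abs_self Cp) hP)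
    rw [map_mul, MvPolynomial.eval_X, abs_mul, pow_succ, ← mul_assoc]
    exact mul_le_mul hpv hx (abs_nonneg _) (by positivity)

/-- The coordinate map of a box is continuous. [folklore] -/
theorem continuous_coordMap {n : ℕ} :
    Continuous (fun v : Fin (n + 1) → ℝ × ℝ => fun i : Fin (n + 1) × Bool =>
      if i.2 then (v i.1).2 else (v i.1).1) := by
  refine continuous_pi fun i => ?_
  obtain ⟨j, b⟩ := i
  cases b
  · simpa using (continuous_apply j).fst
  · simpa using (continuous_apply j).snd

/-- Evaluation of a polynomial in the box coordinates is continuous. [folklore] -/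
theorem continuous_mvPolynomial_eval {n : ℕ} (w : MvPolynomial (Fin (n + 1) × Bool) ℝ) :
    Continuous (fun v : Fin (n + 1) → ℝ × ℝ =>
      MvPolynomial.eval (fun i : Fin (n + 1) × Bool => if i.2 then (v i.1).2 else (v i.1).1) w) :=
  (MvPolynomial.continuous_eval w).comp continuous_coordMap

/-! ## The assembly -/

/-- **Parity assembly** of crux `ChargeCompleteness`:
`EvenChargeCompleteness → NoOddDrudeWeight → DrudeWeightExists → ChargeCompleteness` (the three
hypotheses are the route items stmt-17666, stmt-17667, stmt-11916).  See the module docstring for the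
proof. [folklore] -/
theorem chargeCompleteness_of_parity (hE : EvenChargeCompleteness) (hO : NoOddDrudeWeight)
    (hP : DrudeWeightExists) : ChargeCompleteness := by
  intro ω₂ lam β γ hω hl hβ T hT μ hμG hμS hμR D hD hcomm LocPoly LocObs Cons Cov hcl f hf ε hε
  have hE' := hE ω₂ lam β γ hω hl hβ T hT μ hμG hμS hμR D hD hcomm hcl
  have hO' := hO ω₂ lam β γ hω hl hβ T hT μ hμG hμS hμR D hD hcomm hcl
  have hP' := hP ω₂ lam β γ hω hl hβ T hT μ hμG hμS hμR D hD hcomm hcl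
  have hf' : LocObs f := hf
  obtain ⟨a, n, g, hg, ⟨C, k, hCk⟩, hfg⟩ := hf
  -- the box reversal
  let Rb : (Fin (n + 1) → ℝ × ℝ) → (Fin (n + 1) → ℝ × ℝ) := fun v i => ((v i).1, -(v i).2)
  have hRb_cont : Continuous Rb :=
    continuous_pi fun i => ((continuous_apply i).fst).prodMk ((continuous_apply i).snd).neg
  have hRb_norm : ∀ v, ‖Rb v‖ = ‖v‖ := by
    intro v
    simp only [Rb, Pi.norm_def, Prod.nnnorm_def, nnnorm_neg]
  -- even and odd parts of f
  let fe : ChainConfig → ℝ := fun σ => (f σ + f (fun x : ℤ => ((σ x).1, -(σ x).2))) / 2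
  let fo : ChainConfig → ℝ := fun σ => (f σ - f (fun x : ℤ => ((σ x).1, -(σ x).2))) / 2
  have hfR : ∀ σ : ChainConfig,
      f (fun x : ℤ => ((σ x).1, -(σ x).2)) = g (Rb (boxRestrictAt a n σ)) :=
    fun σ => hfg _
  have hfe : LocObs fe := by
    refine ⟨a, n, fun v => (g v + g (Rb v)) / 2, (hg.add (hg.comp hRb_cont)).div_const _,
      ⟨C, k, ?_⟩, ?_⟩
    · intro v
      have h1 := hCk v
      have h2 := hCk (Rb v)
      rw [hRb_norm] at h2
      rw [abs_div, abs_two]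
      have := abs_add_le (g v) (g (Rb v))
      linarith
    · intro σ
      simp only [fe, hfR σ, hfg σ]
  have hfo : LocObs fo := by
    refine ⟨a, n, fun v => (g v - g (Rb v)) / 2, (hg.sub (hg.comp hRb_cont)).div_const _,
      ⟨C, k, ?_⟩, ?_⟩
    · intro v
      have h1 := hCk v
      have h2 := hCk (Rb v)
      rw [hRb_norm] at h2
      rw [abs_div, abs_two]
      have := abs_sub (g v) (g (Rb v))
      linarith
    · intro σ
      simp only [fo, hfR σ, hfg σ]
  have hfe_even : ∀ σ : ChainConfig, fe (fun x : ℤ => ((σ x).1, -(σ x).2)) = fe σ := by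
    intro σ
    simp only [fe, neg_neg, Prod.mk.eta]
    ring
  have hfo_odd : ∀ σ : ChainConfig, fo (fun x : ℤ => ((σ x).1, -(σ x).2)) = -fo σ := by
    intro σ
    simp only [fo, neg_neg, Prod.mk.eta]
    ring
  have hsum : (fun σ => fe σ + fo σ) = f := by
    funext σ
    simp only [fe, fo]
    ring
  have hdec : ∀ σ, f σ = fe σ + fo σ := fun σ => by
    simp only [fe, fo]
    ring
  -- LocObs bookkeeping: constants, local polynomials, single-factor integrability
  have hone : LocObs (fun _ => (1 : ℝ)) :=
    ⟨0, 0, fun _ => 1, continuous_const, ⟨1, 0, fun v => by simp⟩, fun σ => rfl⟩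
  have hpoly : ∀ Q : ChainConfig → ℝ, LocPoly Q → LocObs Q := by
    rintro Q ⟨a', n', w, hw⟩
    obtain ⟨C', k', hC'⟩ := mvPolynomial_eval_bound w
    exact ⟨a', n', fun v => MvPolynomial.eval
      (fun i : Fin (n' + 1) × Bool => if i.2 then (v i.1).2 else (v i.1).1) w,
      continuous_mvPolynomial_eval w, ⟨C', k', hC'⟩, fun σ => hw σ⟩
  have hint1 : ∀ u : ChainConfig → ℝ, LocObs u → ∀ t : ℝ,
      Integrable (fun σ => u (D.flow t σ)) μ := by
    intro u hu t
    simpa using (hcl u (fun _ => (1 : ℝ)) hu hone).1 t 0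
  -- shifted single-factor integrability
  have hint2 : ∀ u : ChainConfig → ℝ, LocObs u → ∀ x : ℤ,
      Integrable (fun σ => u (fun y => σ (y + x))) μ := by
    intro u hu x
    simpa using (hcl (fun _ => (1 : ℝ)) u hone hu).1 0 x
  -- the pencil fe + s·fo stays in LocObs (same box)
  have hfs : ∀ s : ℝ, LocObs (fun σ => fe σ + s * fo σ) := by
    intro s
    refine ⟨a, n, fun v => (g v + g (Rb v)) / 2 + s * ((g v - g (Rb v)) / 2),
      ((hg.add (hg.comp hRb_cont)).div_const _).add
        (continuous_const.mul ((hg.sub (hg.comp hRb_cont)).div_const _)), ⟨(1 + |s|) * |C|, k, ?_⟩, ?_⟩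
    · intro v
      have h1 := hCk v
      have h2 := hCk (Rb v)
      rw [hRb_norm] at h2
      have hP0 : (0 : ℝ) ≤ (1 + ‖v‖) ^ k := by positivity
      have hC : C * (1 + ‖v‖) ^ k ≤ |C| * (1 + ‖v‖) ^ k :=
        mul_le_mul_of_nonneg_right (le_abs_self C) hP0
      have he : |(g v + g (Rb v)) / 2| ≤ |C| * (1 + ‖v‖) ^ k := by
        rw [abs_div, abs_two]
        have := abs_add_le (g v) (g (Rb v))
        linarith
      have ho : |(g v - g (Rb v)) / 2| ≤ |C| * (1 + ‖v‖) ^ k := by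
        rw [abs_div, abs_two]
        have := abs_sub (g v) (g (Rb v))
        linarith
      have hs0 : 0 ≤ |s| := abs_nonneg s
      calc |(g v + g (Rb v)) / 2 + s * ((g v - g (Rb v)) / 2)|
          ≤ |(g v + g (Rb v)) / 2| + |s * ((g v - g (Rb v)) / 2)| := abs_add_le _ _
        _ = |(g v + g (Rb v)) / 2| + |s| * |(g v - g (Rb v)) / 2| := by rw [abs_mul]
        _ ≤ |C| * (1 + ‖v‖) ^ k + |s| * (|C| * (1 + ‖v‖) ^ k) := by
            gcongr
        _ = (1 + |s|) * |C| * (1 + ‖v‖) ^ k := by ring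
    · intro σ
      simp only [fe, fo, hfR σ, hfg σ]
  -- bilinearity of Cov along the pencil, pointwise in (t, x)
  have hcov_bil : ∀ (s t : ℝ) (x : ℤ),
      Cov (fun σ => fe σ + s * fo σ) (fun σ => fe σ + s * fo σ) t x
        = Cov fe fe t x + s * (Cov fe fo t x + Cov fo fe t x) + s ^ 2 * Cov fo fo t x := by
    intro s t x
    have Iee : Integrable (fun σ => fe (D.flow t σ) * fe (fun y => σ (y + x))) μ :=
      (hcl fe fe hfe hfe).1 t x
    have Ieo : Integrable (fun σ => fe (D.flow t σ) * fo (fun y => σ (y + x))) μ :=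
      (hcl fe fo hfe hfo).1 t x
    have Ioe : Integrable (fun σ => fo (D.flow t σ) * fe (fun y => σ (y + x))) μ :=
      (hcl fo fe hfo hfe).1 t x
    have Ioo : Integrable (fun σ => fo (D.flow t σ) * fo (fun y => σ (y + x))) μ :=
      (hcl fo fo hfo hfo).1 t x
    have IsB : Integrable (fun σ => s * (fe (D.flow t σ) * fo (fun y => σ (y + x)))) μ :=
      Ieo.const_mul s
    have IsC : Integrable (fun σ => s * (fo (D.flow t σ) * fe (fun y => σ (y + x)))) μ :=
      Ioe.const_mul s
    have IsD : Integrable (fun σ => s ^ 2 * (fo (D.flow t σ) * fo (fun y => σ (y + x)))) μ :=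
      Ioo.const_mul (s ^ 2)
    have IAB : Integrable (fun σ => fe (D.flow t σ) * fe (fun y => σ (y + x))
        + s * (fe (D.flow t σ) * fo (fun y => σ (y + x)))) μ := Iee.add IsB
    have IABC : Integrable (fun σ => fe (D.flow t σ) * fe (fun y => σ (y + x))
        + s * (fe (D.flow t σ) * fo (fun y => σ (y + x)))
        + s * (fo (D.flow t σ) * fe (fun y => σ (y + x)))) μ := IAB.add IsC
    have e1 : ∫ σ, (fe (D.flow t σ) + s * fo (D.flow t σ)) *
          (fe (fun y => σ (y + x)) + s * fo (fun y => σ (y + x))) ∂μ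
        = (∫ σ, fe (D.flow t σ) * fe (fun y => σ (y + x)) ∂μ)
          + s * (∫ σ, fe (D.flow t σ) * fo (fun y => σ (y + x)) ∂μ)
          + s * (∫ σ, fo (D.flow t σ) * fe (fun y => σ (y + x)) ∂μ)
          + s ^ 2 * (∫ σ, fo (D.flow t σ) * fo (fun y => σ (y + x)) ∂μ) := by
      have h : (fun σ => (fe (D.flow t σ) + s * fo (D.flow t σ)) *
            (fe (fun y => σ (y + x)) + s * fo (fun y => σ (y + x))))
          = fun σ => fe (D.flow t σ) * fe (fun y => σ (y + x))
              + s * (fe (D.flow t σ) * fo (fun y => σ (y + x)))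
              + s * (fo (D.flow t σ) * fe (fun y => σ (y + x)))
              + s ^ 2 * (fo (D.flow t σ) * fo (fun y => σ (y + x))) := by
        funext σ
        ring
      rw [h, integral_add IABC IsD, integral_add IAB IsC,
        integral_add Iee IsB, integral_const_mul, integral_const_mul, integral_const_mul]
    have e2 : ∫ σ, (fe (D.flow t σ) + s * fo (D.flow t σ)) ∂μ
        = (∫ σ, fe (D.flow t σ) ∂μ) + s * (∫ σ, fo (D.flow t σ) ∂μ) := by
      have I2 : Integrable (fun σ => s * fo (D.flow t σ)) μ := (hint1 fo hfo t).const_mul s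
      rw [integral_add (hint1 fe hfe t) I2, integral_const_mul]
    have e3 : ∫ σ, (fe (fun y => σ (y + x)) + s * fo (fun y => σ (y + x))) ∂μ
        = (∫ σ, fe (fun y => σ (y + x)) ∂μ) + s * (∫ σ, fo (fun y => σ (y + x)) ∂μ) := by
      have I3 : Integrable (fun σ => s * fo (fun y => σ (y + x))) μ := (hint2 fo hfo x).const_mul s
      rw [integral_add (hint2 fe hfe x) I3, integral_const_mul]
    show (∫ σ, (fe (D.flow t σ) + s * fo (D.flow t σ)) *
            (fe (fun y => σ (y + x)) + s * fo (fun y => σ (y + x))) ∂μ)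
          - (∫ σ, (fe (D.flow t σ) + s * fo (D.flow t σ)) ∂μ)
            * (∫ σ, (fe (fun y => σ (y + x)) + s * fo (fun y => σ (y + x))) ∂μ)
        = ((∫ σ, fe (D.flow t σ) * fe (fun y => σ (y + x)) ∂μ)
            - (∫ σ, fe (D.flow t σ) ∂μ) * (∫ σ, fe (fun y => σ (y + x)) ∂μ))
          + s * (((∫ σ, fe (D.flow t σ) * fo (fun y => σ (y + x)) ∂μ)
              - (∫ σ, fe (D.flow t σ) ∂μ) * (∫ σ, fo (fun y => σ (y + x)) ∂μ))
            + ((∫ σ, fo (D.flow t σ) * fe (fun y => σ (y + x)) ∂μ)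
              - (∫ σ, fo (D.flow t σ) ∂μ) * (∫ σ, fe (fun y => σ (y + x)) ∂μ)))
          + s ^ 2 * ((∫ σ, fo (D.flow t σ) * fo (fun y => σ (y + x)) ∂μ)
            - (∫ σ, fo (D.flow t σ) ∂μ) * (∫ σ, fo (fun y => σ (y + x)) ∂μ))
    rw [e1, e2, e3]
    ring
  -- summability in x at a fixed t ≥ 0 (clause ii)
  have hS : ∀ u v : ChainConfig → ℝ, LocObs u → LocObs v → ∀ t : ℝ, 0 ≤ t →
      Summable (fun x : ℤ => Cov u v t x) := by
    intro u v hu hv t ht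
    obtain ⟨m, hm, hb⟩ := (hcl u v hu hv).2.1 t
    exact hm.of_norm_bounded (fun x => by simpa [Real.norm_eq_abs] using hb t ⟨ht, le_rfl⟩ x)
  -- bilinearity of K along the pencil, for t ≥ 0
  have hK_bil : ∀ (s t : ℝ), 0 ≤ t →
      (∑' x : ℤ, Cov (fun σ => fe σ + s * fo σ) (fun σ => fe σ + s * fo σ) t x)
        = (∑' x : ℤ, Cov fe fe t x)
          + s * ((∑' x : ℤ, Cov fe fo t x) + ∑' x : ℤ, Cov fo fe t x)
          + s ^ 2 * ∑' x : ℤ, Cov fo fo t x := by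
    intro s t ht
    have SA := hS fe fe hfe hfe t ht
    have SB := hS fe fo hfe hfo t ht
    have SC := hS fo fe hfo hfe t ht
    have SD := hS fo fo hfo hfo t ht
    have SBC : Summable (fun x : ℤ => s * (Cov fe fo t x + Cov fo fe t x)) := (SB.add SC).mul_left s
    have SD2 : Summable (fun x : ℤ => s ^ 2 * Cov fo fo t x) := SD.mul_left (s ^ 2)
    have SABC : Summable (fun x : ℤ => Cov fe fe t x + s * (Cov fe fo t x + Cov fo fe t x)) :=
      SA.add SBC
    rw [tsum_congr (fun x => hcov_bil s t x), SABC.tsum_add SD2, SA.tsum_add SBC,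
      tsum_mul_left, tsum_mul_left, SB.tsum_add SC]
  -- bilinearity of the Cesàro means along the pencil, for τ ≥ 0
  have hM_bil : ∀ (s τ : ℝ), 0 ≤ τ →
      τ⁻¹ * ∫ t in (0:ℝ)..τ, ∑' x : ℤ, Cov (fun σ => fe σ + s * fo σ) (fun σ => fe σ + s * fo σ) t x
        = (τ⁻¹ * ∫ t in (0:ℝ)..τ, ∑' x : ℤ, Cov fe fe t x)
          + s * (τ⁻¹ * ∫ t in (0:ℝ)..τ, ((∑' x : ℤ, Cov fe fo t x) + ∑' x : ℤ, Cov fo fe t x))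
          + s ^ 2 * (τ⁻¹ * ∫ t in (0:ℝ)..τ, ∑' x : ℤ, Cov fo fo t x) := by
    intro s τ hτ
    have hcongr : ∫ t in (0:ℝ)..τ,
          ∑' x : ℤ, Cov (fun σ => fe σ + s * fo σ) (fun σ => fe σ + s * fo σ) t x
        = ∫ t in (0:ℝ)..τ, ((∑' x : ℤ, Cov fe fe t x)
            + s * ((∑' x : ℤ, Cov fe fo t x) + ∑' x : ℤ, Cov fo fe t x)
            + s ^ 2 * ∑' x : ℤ, Cov fo fo t x) := by
      apply intervalIntegral.integral_congr
      intro t ht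
      rw [Set.uIcc_of_le hτ] at ht
      exact hK_bil s t ht.1
    have cA : Continuous fun t : ℝ => ∑' x : ℤ, Cov fe fe t x := (hcl fe fe hfe hfe).2.2.2
    have cB : Continuous fun t : ℝ => ∑' x : ℤ, Cov fe fo t x := (hcl fe fo hfe hfo).2.2.2
    have cC : Continuous fun t : ℝ => ∑' x : ℤ, Cov fo fe t x := (hcl fo fe hfo hfe).2.2.2
    have cD : Continuous fun t : ℝ => ∑' x : ℤ, Cov fo fo t x := (hcl fo fo hfo hfo).2.2.2
    have iA : IntervalIntegrable (fun t : ℝ => ∑' x : ℤ, Cov fe fe t x) MeasureTheory.volume 0 τ :=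
      cA.intervalIntegrable 0 τ
    have iBC : IntervalIntegrable
        (fun t : ℝ => s * ((∑' x : ℤ, Cov fe fo t x) + ∑' x : ℤ, Cov fo fe t x))
        MeasureTheory.volume 0 τ := (continuous_const.mul (cB.add cC)).intervalIntegrable 0 τ
    have iD : IntervalIntegrable (fun t : ℝ => s ^ 2 * ∑' x : ℤ, Cov fo fo t x)
        MeasureTheory.volume 0 τ := (continuous_const.mul cD).intervalIntegrable 0 τ
    have iABC : IntervalIntegrable (fun t : ℝ => (∑' x : ℤ, Cov fe fe t x)
        + s * ((∑' x : ℤ, Cov fe fo t x) + ∑' x : ℤ, Cov fo fe t x)) MeasureTheory.volume 0 τ :=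
      iA.add iBC
    rw [hcongr, intervalIntegral.integral_add iABC iD, intervalIntegral.integral_add iA iBC,
      intervalIntegral.integral_const_mul, intervalIntegral.integral_const_mul,
      intervalIntegral.integral_add (cB.intervalIntegrable 0 τ) (cC.intervalIntegrable 0 τ)]
    ring
  -- the pieces at f, fe, fo
  obtain ⟨Df, hDf0, hTf⟩ := hP' f hf'
  obtain ⟨A, hA0, hTe⟩ := hP' fe hfe
  have hTo0 := hO' fo hfo hfo_odd
  obtain ⟨Q, hQP, hQC, hQeven, hQpos, hQev⟩ := hE' fe hfe hfe_even (ε / 2) (half_pos hε)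
  have hQobs : LocObs Q := hpoly Q hQP
  -- the limits, restated over the goal's `Cov`
  have hTf' : Tendsto (fun τ : ℝ => τ⁻¹ * ∫ t in (0:ℝ)..τ, ∑' x : ℤ, Cov f f t x)
      atTop (𝓝 Df) := hTf
  have hTe' : Tendsto (fun τ : ℝ => τ⁻¹ * ∫ t in (0:ℝ)..τ, ∑' x : ℤ, Cov fe fe t x)
      atTop (𝓝 A) := hTe
  have hTo' : Tendsto (fun τ : ℝ => τ⁻¹ * ∫ t in (0:ℝ)..τ, ∑' x : ℤ, Cov fo fo t x)
      atTop (𝓝 0) := hTo0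
  -- (1) the symmetrised cross term has a Cesàro limit, read off at s = 1
  have hsum1 : (fun σ => fe σ + 1 * fo σ) = f := by
    funext σ
    simp only [fe, fo]
    ring
  have hMC : Tendsto (fun τ : ℝ => τ⁻¹ * ∫ t in (0:ℝ)..τ,
      ((∑' x : ℤ, Cov fe fo t x) + ∑' x : ℤ, Cov fo fe t x)) atTop (𝓝 (Df - A - 0)) := by
    refine ((hTf'.sub hTe').sub hTo').congr' ?_
    filter_upwards [eventually_ge_atTop (0 : ℝ)] with τ hτ
    have h := hM_bil 1 τ hτ
    rw [hsum1] at h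
    linarith
  -- (2) along the pencil the Drude weight is affine in s and nonnegative
  have hineq : ∀ s : ℝ, 0 ≤ A + s * (Df - A) := by
    intro s
    obtain ⟨Ds, hDs0, hTs⟩ := hP' (fun σ => fe σ + s * fo σ) (hfs s)
    have hTs' : Tendsto (fun τ : ℝ => τ⁻¹ * ∫ t in (0:ℝ)..τ,
        ∑' x : ℤ, Cov (fun σ => fe σ + s * fo σ) (fun σ => fe σ + s * fo σ) t x)
        atTop (𝓝 Ds) := hTs
    have hlim : Tendsto (fun τ : ℝ => τ⁻¹ * ∫ t in (0:ℝ)..τ,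
        ∑' x : ℤ, Cov (fun σ => fe σ + s * fo σ) (fun σ => fe σ + s * fo σ) t x) atTop
        (𝓝 (A + s * (Df - A - 0) + s ^ 2 * 0)) := by
      refine ((hTe'.add (hMC.const_mul s)).add (hTo'.const_mul (s ^ 2))).congr' ?_
      filter_upwards [eventually_ge_atTop (0 : ℝ)] with τ hτ
      rw [hM_bil s τ hτ]
    have huniq : Ds = A + s * (Df - A - 0) + s ^ 2 * 0 := tendsto_nhds_unique hTs' hlim
    have : A + s * (Df - A - 0) + s ^ 2 * 0 = A + s * (Df - A) := by ring
    linarith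
  have hDfA : Df = A := by
    by_contra hne
    have hδ : Df - A ≠ 0 := sub_ne_zero.2 hne
    have h := hineq (-(A + 1) / (Df - A))
    have hcalc : A + -(A + 1) / (Df - A) * (Df - A) = -1 := by
      field_simp
      ring
    linarith
  -- (3) the even part is ε/2-saturated by the even charge Q
  have hA_le : A ≤ (∑' x : ℤ, Cov fe Q 0 x) ^ 2 / (∑' x : ℤ, Cov Q Q 0 x) + ε / 2 :=
    le_of_tendsto hTe' hQev
  -- (4) ⟨f, Q⟩₀ = ⟨fe, Q⟩₀ : the odd part is invisible to the even charge
  have hQx : ∀ (x : ℤ) (σ : ChainConfig),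
      Q (fun y => ((σ (y + x)).1, -(σ (y + x)).2)) = Q (fun y => σ (y + x)) :=
    fun x σ => hQeven (fun y => σ (y + x))
  have hfo0 : ∀ x : ℤ, ∫ σ, fo (D.flow 0 σ) * Q (fun y => σ (y + x)) ∂μ = 0 := by
    intro x
    have hae : (fun σ => fo (D.flow 0 σ) * Q (fun y => σ (y + x))) =ᵐ[μ]
        fun σ => fo σ * Q (fun y => σ (y + x)) :=
      hD.1.mono fun σ hσ => by simp only [D.flow_zero σ hσ]
    rw [integral_congr_ae hae]
    refine integral_eq_zero_of_odd hμR fun σ => ?_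
    beta_reduce
    rw [hfo_odd σ, hQx x σ]
    ring
  have hfo0' : ∫ σ, fo (D.flow 0 σ) ∂μ = 0 := by
    have hae : (fun σ => fo (D.flow 0 σ)) =ᵐ[μ] fun σ => fo σ :=
      hD.1.mono fun σ hσ => by simp only [D.flow_zero σ hσ]
    rw [integral_congr_ae hae]
    exact integral_eq_zero_of_odd hμR hfo_odd
  have hcov : ∀ x : ℤ, Cov f Q 0 x = Cov fe Q 0 x := by
    intro x
    have hIe : Integrable (fun σ => fe (D.flow 0 σ) * Q (fun y => σ (y + x))) μ :=
      (hcl fe Q hfe hQobs).1 0 x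
    have hIo : Integrable (fun σ => fo (D.flow 0 σ) * Q (fun y => σ (y + x))) μ :=
      (hcl fo Q hfo hQobs).1 0 x
    have i1 : ∫ σ, f (D.flow 0 σ) * Q (fun y => σ (y + x)) ∂μ =
        ∫ σ, fe (D.flow 0 σ) * Q (fun y => σ (y + x)) ∂μ := by
      have h : (fun σ => f (D.flow 0 σ) * Q (fun y => σ (y + x))) =
          fun σ => fe (D.flow 0 σ) * Q (fun y => σ (y + x)) +
            fo (D.flow 0 σ) * Q (fun y => σ (y + x)) := by
        funext σ
        rw [hdec]
        ring
      rw [h, integral_add hIe hIo, hfo0 x, add_zero]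
    have i2 : ∫ σ, f (D.flow 0 σ) ∂μ = ∫ σ, fe (D.flow 0 σ) ∂μ := by
      have h : (fun σ => f (D.flow 0 σ)) = fun σ => fe (D.flow 0 σ) + fo (D.flow 0 σ) := by
        funext σ
        exact hdec _
      rw [h, integral_add (hint1 fe hfe 0) (hint1 fo hfo 0), hfo0', add_zero]
    show (∫ σ, f (D.flow 0 σ) * Q (fun y => σ (y + x)) ∂μ) -
          (∫ σ, f (D.flow 0 σ) ∂μ) * (∫ σ, Q (fun y => σ (y + x)) ∂μ) =
        (∫ σ, fe (D.flow 0 σ) * Q (fun y => σ (y + x)) ∂μ) -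
          (∫ σ, fe (D.flow 0 σ) ∂μ) * (∫ σ, Q (fun y => σ (y + x)) ∂μ)
    rw [i1, i2]
  have htsum : (∑' x : ℤ, Cov f Q 0 x) = ∑' x : ℤ, Cov fe Q 0 x := tsum_congr hcov
  -- (5) assemble
  refine ⟨Q, hQP, hQC, hQpos, ?_⟩
  rw [htsum]
  have hlt : Df < (∑' x : ℤ, Cov fe Q 0 x) ^ 2 / (∑' x : ℤ, Cov Q Q 0 x) + ε := by
    linarith
  exact (hTf'.eventually_lt_const hlt).mono fun τ hτ => hτ.le

/-- The glue item `ChargeCompletenessOfParity` (stmt-AtomisticToContinuum-17668) holds. [folklore] -/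
theorem chargeCompletenessOfParity_holds : ChargeCompletenessOfParity :=
  chargeCompleteness_of_parity

end Summit.AtomisticToContinuum.FouriersLaw.Theorems.NoHiddenChargesKuboChargeCompletenessSplit

end
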